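import Summits.QuantumFields.YangMills.Theorems.BalabanUVNodesN12GuardedChartDerivDeviation
import Literature.MathematicalPhysics.QuantumFieldTheory.Balaban1983to89.Node00.LinearisedAveragingFlat

/-!
# BalabanUVNodes ∕ N12 — (J-iii) JUNCTION WITH n07-w1's `qLin` ∕ `dIterL` (by `rfl`): `DΨ_U(0)` IS `π ∘ qLin`, and `qLin j U − qLin j 1` is linear in `‖↑U − 1‖`

Cell `pub-ymgap` (HUMAN RULINGS D-0062 ∕ D-0149), width seat `pub-ymgap-dag-n10-w1` g0; n07-w1 g0's bus word l.≈27407 («THE FLAT JUNCTION IS IN THE TREE: `Node00.dIterL_one_apply_of_skew`,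
`Node00.qLin_one_eq_family` — cite BY NAME with your recursion family `Q`»).  Key K1⁷ `stmt-QuantumFields-20542`, `--kind proof --supports … --as helper`; count-neutral; THEOREMS ONLY.
CONSUMED BY NAME, nothing modified: n07-w1's `Node00.LinearisedAveragingAtBackground` (`dIterL k V₀ := fderiv ℝ (iterM k) V₀`, `qLin`, `qLin_apply`) and `Node00.LinearisedAveragingFlat`
(`qLin_one_eq_family`), this seat's module D (`exists_norm_leftTriv_fderiv_iterM_sub_iterLin_le`, `exists_norm_suProj_le`; module C's §3 `fderiv_msChart_apply_eq_of_plaqSmall` is re-proved PRIVATELY here — C's farm olean was not built in time; cite C's public original), n07-e's 35b-i (`coeField_avgFamily_eq_iterM`),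
35e (`smallBelow_of_plaqSmall`).

CONTENTS.  §1 ★ `fderiv_msChart_apply_eq_suProj_qLin` — at a guarded `U` (35e's plaquette guard): `(DΦ_U(0)X)_i = π(qLin j U X c)` at the constrained bond `i ↔ (j, c)`.
§2 ★★ `exists_norm_qLin_sub_qLin_one_le` — `∃ C ρ`, for all `j ≤ k`, `‖↑U − 1‖ < ρ`, `X`, `c`: `‖qLin j U X c − qLin j 1 X c‖ ≤ C·‖↑U − 1‖·‖↑X‖` (module D's core estimate with the
canonical recursion family, read through `qLin_one_eq_family`); ★ `exists_norm_fderiv_msChart_sub_suProj_qLin_one_le` — the `(δ₂)` letter in `qLin` currency.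

HONEST FRAMING.  Junction bookkeeping by `rfl` + module D; ∃-constants by smoothness near the flat configuration, not print's `O(L²α₀)`; nothing of Bałaban's estimates asserted; N12 NOT
discharged; count-neutral (typed 28∕28 · discharged 5∕27 unmoved); one finite 𝕋⁴ programme at fixed ε — R4 closes the conditional rung `BalabanLadder.UV` only; the YM mass gap (Clay)
is NOT proved by any of this.  No `sorry`, no `def`, no `instance`, no `notation`.
-/

noncomputable section

open scoped BigOperators Matrix.Norms.L2Operator Topology NNReal
open Filter Asymptotics Finset

namespace Summit.QuantumFields.YangMills.BalabanUVNodes.N12GuardedChartDerivQLinJunction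

open Literature.MathematicalPhysics.QuantumFieldTheory.Balaban1983to89
open T4Continuum (T4Family)
open BlockAveraging (blockAvg)
open ExpMeanLog (expMeanLogSU deltaSU deltaSU_pos)
open BlockAveragingEMLLinearised (linAvg)
open T4AdjointCovarianceUnitary (lieSU expSU)
open B15DeterminingSets
open Node00
open Summit.QuantumFields.YangMills.Theorems.BlockAvgCorrector (stokesConst stokesConst_nonneg)
open Summit.QuantumFields.YangMills.BalabanUVNodes.N07CritTangentConverse (smallBelow_of_plaqSmall)
open Summit.QuantumFields.YangMills.BalabanUVNodes.N07CritTangentConverse (hasDerivAt_coeField_iter)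
open Summit.QuantumFields.YangMills.BalabanUVNodes.N12GuardedChartDerivDeviation (exists_norm_leftTriv_fderiv_iterM_sub_iterLin_le exists_norm_suProj_le)

/-! ## §1  `DΨ_U(0) = π ∘ qLin` at a guarded configuration -/

section Chart

variable {F : T4Family} {N : ℕ} [NeZero N] {K k : ℕ}

/-- (module C §3 `…N12GuardedChartDerivIterLin.fderiv_msChart_apply_eq_of_plaqSmall`, private verbatim copy — cite the public original) `(DΦ_U(0)X)_{(j,c)} = π((M˙U)_j(c)*·(D(Ū^j)(↑U)(↑U·↑X))(c))`
on 35e's guard. [cite: Balaban1985Variational, (44)-(48) p.285, (83) p.290; Balaban1987RG1, (0.21) p.256] -/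
private theorem fderiv_msChart_apply_eq_of_plaqSmall {t₀ : ℝ} (ht₀ : 0 < t₀) (hstδ : stokesConst (F.P K) * t₀ < deltaSU (Fin N))
    {U : GaugeField (F.P K) 0 (SU N)} (hsm : ∀ i, i < k → PlaqSmall t₀ (Averaging.iter (avOfRecord F N K) i U))
    (𝔹 : DetSet (F.P K)) (X : PBond (F.P K) 0 → lieSU (Fin N)) (i : Fin (constrCard 𝔹 k)) :
    fderiv ℝ (msChart F N K k 𝔹 (avgFamily (avOfRecord F N K) U) U) 0 X i
      = suProj N (star ((avgFamily (avOfRecord F N K) U ((constrEnum 𝔹 k).symm i).1 ((constrEnum 𝔹 k).symm i).2.1 : SU N) : Matrix (Fin N) (Fin N) ℂ) *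
          fderiv ℝ (iterM (((constrEnum 𝔹 k).symm i).1 : ℕ))
            (coeField U) (fun b => (U b : Matrix (Fin N) (Fin N) ℂ) * (X b : Matrix (Fin N) (Fin N) ℂ)) ((constrEnum 𝔹 k).symm i).2.1) := by
  set s := (constrEnum 𝔹 k).symm i with hs
  have hj : (s.1 : ℕ) ≤ k := Nat.lt_succ_iff.1 s.1.2
  have hΓ : HasDerivAt (fun t : ℝ => coeField (expChart U (t • X))) (fun b => (U b : Matrix (Fin N) (Fin N) ℂ) * (X b : Matrix (Fin N) (Fin N) ℂ)) 0 :=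
    hasDerivAt_pi.2 fun b => hasDerivAt_coe_expChart_along (hasDerivAt_ray X) (zero_smul ℝ X) b
  have hsm' : ∀ i', i' < (s.1 : ℕ) → PlaqSmall t₀ (Averaging.iter (fun i => blockAvg (P := F.P K) (j := i) (expMeanLogSU (n := Fin N))) i' (expChart U ((0 : ℝ) • X))) :=
    fun i' hi' => by rw [zero_smul, expChart_zero]; exact hsm i' (lt_of_lt_of_le hi' hj)
  have hvel := hasDerivAt_coeField_iter (k := (s.1 : ℕ)) ht₀ hstδ hΓ hsm'
  have hvelc : HasDerivAt (fun t : ℝ => ((avgFamily (avOfRecord F N K) (expChart U (t • X)) s.1 s.2.1 : SU N) : Matrix (Fin N) (Fin N) ℂ))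
      (fderiv ℝ (iterM (s.1 : ℕ)) (coeField U) (fun b => (U b : Matrix (Fin N) (Fin N) ℂ) * (X b : Matrix (Fin N) (Fin N) ℂ)) s.2.1) 0 := by
    have h := (hasDerivAt_pi.1 hvel) s.2.1
    rw [zero_smul, expChart_zero] at h
    exact h
  have hsb : SmallBelow (avOfRecord F N K) k U := smallBelow_of_plaqSmall ht₀ hstδ hsm
  exact fderiv_msChart_apply_of_hasDerivAt (fun _ _ _ => rfl) hsb X i hvelc

/-- ★ **`(DΦ_U(0)X)_i = π(qLin j U X c)`** at a configuration on 35e's plaquette guard — module C §3 read through n07-w1's `qLin` (`dIterL j ↑U = fderiv ℝ (iterM j) ↑U` by `rfl`,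
`↑Ū^j(U)(c) = (iterM j ↑U)(c)` under the guard). [cite: Balaban1985Variational, (44)-(48) p.285, (83) p.290; Balaban1987RG1, (0.21) p.256] -/
theorem fderiv_msChart_apply_eq_suProj_qLin {t₀ : ℝ} (ht₀ : 0 < t₀) (hstδ : stokesConst (F.P K) * t₀ < deltaSU (Fin N))
    {U : GaugeField (F.P K) 0 (SU N)} (hsm : ∀ i, i < k → PlaqSmall t₀ (Averaging.iter (avOfRecord F N K) i U))
    (𝔹 : DetSet (F.P K)) (X : PBond (F.P K) 0 → lieSU (Fin N)) (i : Fin (constrCard 𝔹 k)) :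
    fderiv ℝ (msChart F N K k 𝔹 (avgFamily (avOfRecord F N K) U) U) 0 X i
      = suProj N (qLin (((constrEnum 𝔹 k).symm i).1 : ℕ) U X ((constrEnum 𝔹 k).symm i).2.1) := by
  set s := (constrEnum 𝔹 k).symm i with hs
  have hj : (s.1 : ℕ) ≤ k := Nat.lt_succ_iff.1 s.1.2
  have hsb : SmallBelow (avOfRecord F N K) (s.1 : ℕ) U := (smallBelow_of_plaqSmall ht₀ hstδ hsm).mono hj
  have hWeq : ((avgFamily (avOfRecord F N K) U s.1 s.2.1 : SU N) : Matrix (Fin N) (Fin N) ℂ)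
      = (iterM (s.1 : ℕ) : (PBond (F.P K) 0 → Matrix (Fin N) (Fin N) ℂ) → PBond (F.P K) s.1 → Matrix (Fin N) (Fin N) ℂ) (coeField U) s.2.1 := by
    have h := congrFun (coeField_avgFamily_eq_iterM (k := (s.1 : ℕ)) hsb) s.2.1
    rw [coeField_apply] at h
    exact h
  rw [fderiv_msChart_apply_eq_of_plaqSmall ht₀ hstδ hsm 𝔹 X i, qLin_apply, ← hWeq]
  rfl

end Chart

/-! ## §2  `qLin j U − qLin j 1` is linear in `‖↑U − 1‖` near the flat configuration -/

section Deviation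

variable {P : Params} {N : ℕ} [NeZero N]

/-- ★★ **`‖qLin j U X c − qLin j 1 X c‖ ≤ C·‖↑U − 1‖·‖↑X‖`** for all `j ≤ k`, `‖↑U − 1‖ < ρ` (`C, ρ` depending on the torus, `N`, `k` only): module D's core estimate for the canonical
recursion family `Q^{(i+1)} = linAvg ∘ Q^{(i)}` and n07-w1's `qLin_one_eq_family` (`qLin j 1 X = Q^{(j)}↑X`). [cite: Balaban1985Averaging, Prop. 3 (121)-(125) p.36;
Balaban1985Variational, (44)-(48) p.285; Balaban1987RG1, (0.21) p.256] -/
theorem exists_norm_qLin_sub_qLin_one_le (k : ℕ) :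
    ∃ C ρ : ℝ, 0 ≤ C ∧ 0 < ρ ∧ ∀ j, j ≤ k → ∀ U : GaugeField P 0 (SU N), ‖coeField U - 1‖ < ρ →
      ∀ (X : PBond P 0 → lieSU (Fin N)) (c : PBond P j),
        ‖qLin j U X c - qLin j (1 : GaugeField P 0 (SU N)) X c‖ ≤ C * ‖coeField U - 1‖ * ‖(fun b => (X b : Matrix (Fin N) (Fin N) ℂ))‖ := by
  -- the canonical recursion family
  let Q : (i : ℕ) → (PBond P 0 → Matrix (Fin N) (Fin N) ℂ) → PBond P i → Matrix (Fin N) (Fin N) ℂ := fun i =>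
    Nat.rec (motive := fun i => (PBond P 0 → Matrix (Fin N) (Fin N) ℂ) → PBond P i → Matrix (Fin N) (Fin N) ℂ)
      (fun Y => Y) (fun i Qi Y c => linAvg (Qi Y) c) i
  have hQ0 : ∀ Y, Q 0 Y = Y := fun _ => rfl
  have hQs : ∀ (i : ℕ) (Y : PBond P 0 → Matrix (Fin N) (Fin N) ℂ) (c : PBond P (i + 1)), Q (i + 1) Y c = linAvg (Q i Y) c := fun _ _ _ => rfl
  obtain ⟨C, ρ, hC, hρ, h⟩ := exists_norm_leftTriv_fderiv_iterM_sub_iterLin_le Q hQ0 hQs k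
  refine ⟨C, ρ, hC, hρ, fun j hj U hU X c => ?_⟩
  rw [qLin_one_eq_family Q hQ0 hQs j X, qLin_apply]
  exact h j hj U hU X c

end Deviation

/-! ## §3  The `(δ₂)` letter in `qLin` currency -/

section Letter

variable {F : T4Family} {N : ℕ} [NeZero N] {K k : ℕ}

/-- ★ **THE `(δ₂)` LETTER IN `qLin` CURRENCY**: `∃ C ρ` (before `U`) with `‖(DΦ_U(0)X)_i − π(qLin j 1 X c)‖ ≤ C·‖↑U − 1‖·‖↑X‖` for every guarded `U` with `‖↑U − 1‖ < ρ`, where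
`qLin j 1 X = Q^{(j)}↑X` for every recursion family (n07-w1). [cite: Balaban1985Averaging, Prop. 3 (121)-(125) p.36; Balaban1985Variational, (44)-(48) p.285, (83) p.290] -/
theorem exists_norm_fderiv_msChart_sub_suProj_qLin_one_le :
    ∃ C ρ : ℝ, 0 ≤ C ∧ 0 < ρ ∧ ∀ ⦃t₀ : ℝ⦄, 0 < t₀ → stokesConst (F.P K) * t₀ < deltaSU (Fin N) →
      ∀ U : GaugeField (F.P K) 0 (SU N), (∀ i, i < k → PlaqSmall t₀ (Averaging.iter (avOfRecord F N K) i U)) → ‖coeField U - 1‖ < ρ →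
      ∀ (𝔹 : DetSet (F.P K)) (X : PBond (F.P K) 0 → lieSU (Fin N)) (i : Fin (constrCard 𝔹 k)),
        ‖fderiv ℝ (msChart F N K k 𝔹 (avgFamily (avOfRecord F N K) U) U) 0 X i
            - suProj N (qLin (((constrEnum 𝔹 k).symm i).1 : ℕ) (1 : GaugeField (F.P K) 0 (SU N)) X ((constrEnum 𝔹 k).symm i).2.1)‖
          ≤ C * ‖coeField U - 1‖ * ‖(fun b => (X b : Matrix (Fin N) (Fin N) ℂ))‖ := by
  obtain ⟨C₀, ρ, hC₀, hρ, hcore⟩ := exists_norm_qLin_sub_qLin_one_le (P := F.P K) (N := N) k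
  obtain ⟨cπ, hcπ, hπ⟩ := exists_norm_suProj_le (N := N)
  refine ⟨cπ * C₀, ρ, by positivity, hρ, fun t₀ ht₀ hstδ U hsm hU 𝔹 X i => ?_⟩
  have hj : ((((constrEnum 𝔹 k).symm i).1 : ℕ)) ≤ k := Nat.lt_succ_iff.1 ((constrEnum 𝔹 k).symm i).1.2
  rw [fderiv_msChart_apply_eq_suProj_qLin ht₀ hstδ hsm 𝔹 X i, ← map_sub]
  calc _ ≤ cπ * _ := hπ _
    _ ≤ cπ * (C₀ * ‖coeField U - 1‖ * ‖(fun b => (X b : Matrix (Fin N) (Fin N) ℂ))‖) :=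
        mul_le_mul_of_nonneg_left (hcore _ hj U hU X _) hcπ
    _ = cπ * C₀ * ‖coeField U - 1‖ * ‖(fun b => (X b : Matrix (Fin N) (Fin N) ℂ))‖ := by ring

end Letter

end Summit.QuantumFields.YangMills.BalabanUVNodes.N12GuardedChartDerivQLinJunction

end
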